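import Mathlib.Data.Matrix.Mul
import Mathlib.LinearAlgebra.Matrix.DotProduct
import Mathlib.LinearAlgebra.Span.Basic
import Mathlib.Data.Real.Basic
import Mathlib.Data.Finset.Lattice.Fold
import Mathlib.Tactic.Linarith
import Mathlib.Tactic.FieldSimp
import Mathlib.Tactic.Ring
import HarnessLib

/-!
# Geometry of the alternative-form LP `Ax ≥ b`: feasible descent directions, the vertex-finding
# step, vertex minimisers and the phase-1 problem (Antoniou–Lu, §11.2.3–11.2.4)

[AL07] = A. Antoniou, W.-S. Lu, *Practical Optimization* [AntoniouLu2007], §11.2.3 "Geometry of an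
LP problem" and §11.2.4 "Vertex minimizers", pp. 327–342 (held copy
`book:antoniou2007-practical-optimization`, read).

Setting: the alternative-form LP `minimise cᵀx subject to Ax ≥ b` ((11.2)), rows `a_iᵀ` of `A`
indexed by a finite type `m`; the constraint `i` is *active* at `x` when `a_iᵀx = b_i`, and the
active constraint matrix `A_a` collects the active rows ((11.13)).

* **Feasible descent directions, Theorem 11.3** ((11.12)–(11.15)).  `d` is a feasible descent
  direction at `x` iff `A_a d ≥ 0` and `cᵀd < 0` ((11.14)).  Sufficiency half of Theorem 11.3 in the
  form the text argues it: if `cᵀd ≥ 0` for every `d` with `A_a d ≥ 0`, then `x` is a minimiser —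
  because for any feasible `y` the direction `d = y − x` has `A_a d ≥ 0` (`activeRows_dir_nonneg`,
  `optimal_of_no_feasible_descent`).
* **Finding a vertex, (11.17)–(11.22).**  Move along `d_k ∈ N(A_{a_k})` ((11.18)): active
constraints
  stay active (`active_preserved`); an inactive constraint `i` *decreasing* w.r.t. `d_k`
  (`a_iᵀd_k < 0`) becomes active exactly at `α = (a_iᵀx_k − b_i)/(−a_iᵀd_k)` ((11.19),
  `decreasing_active_at_ratio`) and stays satisfied for smaller `α`
  (`decreasing_feasible_of_le_ratio`);
  non-decreasing constraints stay satisfied for every `α ≥ 0` (`nondecreasing_feasible`); hence the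
  step `α_k = min_{i ∈ I_k}(…)` of (11.21) keeps `x_{k+1} = x_k + α_k d_k` feasible
  (`step_feasible`).  The rank gain (11.22): a row with `a_iᵀd_k ≠ 0` is NOT in the span of rows
  annihilating `d_k` (`row_not_mem_span_of_dir`), so appending `a_{i*}ᵀ` to `A_{a_k}` raises the
  rank.
* **Vertex minimisers, Theorems 11.5 and 11.7** (§11.2.4).  With `c = A_aᵀμ_a` ((11.35)) the
  objective is constant along `N(A_a)` (`objective_const_of_nullspace_dir`, the step of Theorem
  11.5),
  and with `μ_a > 0` any other minimiser keeps the active constraints tight, whence uniqueness when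
  `rank A_{a*} = n` (`active_dirs_vanish_of_positive_multipliers`,
  `unique_minimizer_of_positive_multipliers`).
* **Phase 1, (11.23)–(11.25).**  `x = 0`, `φ₀ = max(0, b_1, …, b_p)` is feasible for
  `Ax + φe ≥ b, φ ≥ 0` (`phaseOne_initial_feasible`); a phase-1 point with `φ = 0` is feasible for
  the
  original constraints (`feasible_of_phaseOne_zero`), and if the original problem is feasible the
  phase-1 optimal value is `0` (`phaseOne_value_zero_of_feasible`), so a positive phase-1 minimum
  certifies infeasibility (`infeasible_of_phaseOne_pos`).

In the tree already (named, not restated, not imported): the standard-form ratio test of the simplex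
method (`RatioTest`), LY08's artificial-variable phase 1 for `Ax = b, x ≥ 0`
(`PhaseOneArtificialVariables`) and the general first-order condition over feasible directions
(`FeasibleDirectionConditions`); this file is the inequality-form geometry of [AL07] §11.2.3.

Published results only (Lean placement rule): every public declaration carries its
`[cite: AntoniouLu2007, §11.2.3/§11.2.4 …]` locator.
-/

namespace Literature.Analysis.Convex.LPVertexFinding

open Matrix Finset

variable {m n : Type*} [Fintype n]

/-- Feasibility for the alternative form: `Ax ≥ b` entrywise. [cite: AntoniouLu2007, §11.2.3
(11.2b)] -/
def Feasible (A : Matrix m n ℝ) (b : m → ℝ) (x : n → ℝ) : Prop := ∀ i, b i ≤ (A *ᵥ x) i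

/-- The constraint `i` is active at `x`: `a_iᵀx = b_i`. [cite: AntoniouLu2007, §11.2.3 (11.13)] -/
def Active (A : Matrix m n ℝ) (b : m → ℝ) (x : n → ℝ) (i : m) : Prop := (A *ᵥ x) i = b i

/-- Along `x + αd` the `i`-th residual is `(a_iᵀx − b_i) + α a_iᵀd`.
[cite: AntoniouLu2007, §11.2.3 (display after (11.18))] -/
theorem residual_along (A : Matrix m n ℝ) (b : m → ℝ) (x d : n → ℝ) (α : ℝ) (i : m) :
    (A *ᵥ (x + α • d)) i - b i = ((A *ᵥ x) i - b i) + α * (A *ᵥ d) i := by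
  simp only [mulVec_add, mulVec_smul, Pi.add_apply, Pi.smul_apply, smul_eq_mul]; ring

/-- **(11.14), first half.** For a feasible `y`, the direction `d = y − x` satisfies `A_a d ≥ 0`:
`a_iᵀ(y − x) ≥ 0` for every constraint active at `x`. [cite: AntoniouLu2007, §11.2.3 (11.14)] -/
theorem activeRows_dir_nonneg (A : Matrix m n ℝ) (b : m → ℝ) {x y : n → ℝ} (hy : Feasible A b y)
    {i : m} (hi : Active A b x i) : 0 ≤ (A *ᵥ (y - x)) i := by
  have := hy i
  rw [mulVec_sub, Pi.sub_apply, hi]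
  linarith

/-- **Theorem 11.3 (sufficiency).** If `x` is feasible and `cᵀd ≥ 0` for all `d` with `A_a d ≥ 0`,
then `x` minimises `cᵀx` over `Ax ≥ b`. [cite: AntoniouLu2007, §11.2.3 Theorem 11.3, (11.15)] -/
theorem optimal_of_no_feasible_descent (A : Matrix m n ℝ) (b : m → ℝ) (c : n → ℝ) {x : n → ℝ}
    (hcond : ∀ d : n → ℝ, (∀ i, Active A b x i → 0 ≤ (A *ᵥ d) i) → 0 ≤ c ⬝ᵥ d)
    {y : n → ℝ} (hy : Feasible A b y) : c ⬝ᵥ x ≤ c ⬝ᵥ y := by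
  have h := hcond (y - x) fun i hi => activeRows_dir_nonneg A b hy hi
  rw [dotProduct_sub] at h
  linarith

/-- **Theorem 11.3 (necessity, contrapositive).** A feasible descent direction — `cᵀd < 0` with
`x + αd` feasible for some `α > 0` — shows that `x` is not a minimiser.
[cite: AntoniouLu2007, §11.2.3 (11.12), Theorem 11.3] -/
theorem not_optimal_of_feasible_descent (A : Matrix m n ℝ) (b : m → ℝ) (c : n → ℝ) {x d : n → ℝ}
    {α : ℝ} (hα : 0 < α) (hfeas : Feasible A b (x + α • d)) (hcd : c ⬝ᵥ d < 0) :
    ∃ y, Feasible A b y ∧ c ⬝ᵥ y < c ⬝ᵥ x :=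
  ⟨x + α • d, hfeas, by rw [dotProduct_add, dotProduct_smul, smul_eq_mul]; nlinarith⟩

/-- **(11.18).** Moving along `d ∈ N(A_a)` keeps every active constraint active.
[cite: AntoniouLu2007, §11.2.3 (11.17)–(11.18)] -/
theorem active_preserved (A : Matrix m n ℝ) (b : m → ℝ) {x d : n → ℝ} {i : m} (hi : Active A b x i)
    (hd : (A *ᵥ d) i = 0) (α : ℝ) : Active A b (x + α • d) i := by
  unfold Active at hi ⊢
  have := residual_along A b x d α i
  rw [hd, mul_zero, add_zero, hi, sub_self] at this
  linarith

/-- **(11.19).** A decreasing inactive constraint (`a_iᵀx − b_i > 0`, `a_iᵀd < 0`) becomes active at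
`α_i = (a_iᵀx − b_i)/(−a_iᵀd)`, a positive step. [cite: AntoniouLu2007, §11.2.3 (11.19)] -/
theorem decreasing_active_at_ratio (A : Matrix m n ℝ) (b : m → ℝ) {x d : n → ℝ} {i : m}
    (hd : (A *ᵥ d) i < 0) :
    Active A b (x + (((A *ᵥ x) i - b i) / (-(A *ᵥ d) i)) • d) i := by
  unfold Active
  have h := residual_along A b x d (((A *ᵥ x) i - b i) / (-(A *ᵥ d) i)) i
  have hne : -(A *ᵥ d) i ≠ 0 := by linarith
  have key : ((A *ᵥ x) i - b i) / (-(A *ᵥ d) i) * (A *ᵥ d) i = -((A *ᵥ x) i - b i) := by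
    rw [div_mul_eq_mul_div, div_eq_iff hne]; ring
  rw [key] at h
  linarith

/-- The ratio of a decreasing inactive constraint is positive. [cite: AntoniouLu2007, §11.2.3
(11.19)] -/
theorem ratio_pos (A : Matrix m n ℝ) (b : m → ℝ) {x d : n → ℝ} {i : m} (hx : b i < (A *ᵥ x) i)
    (hd : (A *ᵥ d) i < 0) : 0 < ((A *ᵥ x) i - b i) / (-(A *ᵥ d) i) :=
  div_pos (by linarith) (by linarith)

/-- For a decreasing constraint, every step `0 ≤ α ≤ α_i` keeps it satisfied.
[cite: AntoniouLu2007, §11.2.3 (11.19)–(11.21)] -/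
theorem decreasing_feasible_of_le_ratio (A : Matrix m n ℝ) (b : m → ℝ) {x d : n → ℝ} {i : m}
    (hd : (A *ᵥ d) i < 0) {α : ℝ} (hα : α ≤ ((A *ᵥ x) i - b i) / (-(A *ᵥ d) i)) :
    b i ≤ (A *ᵥ (x + α • d)) i := by
  have h := residual_along A b x d α i
  have hpos : 0 < -(A *ᵥ d) i := by linarith
  have : α * (-(A *ᵥ d) i) ≤ (A *ᵥ x) i - b i := (le_div_iff₀ hpos).mp hα
  linarith

/-- A constraint that is non-decreasing w.r.t. `d` (`a_iᵀd ≥ 0`) stays satisfied for all `α ≥ 0`.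
[cite: AntoniouLu2007, §11.2.3 (paragraph before (11.20))] -/
theorem nondecreasing_feasible (A : Matrix m n ℝ) (b : m → ℝ) {x d : n → ℝ} {i : m}
    (hx : b i ≤ (A *ᵥ x) i) (hd : 0 ≤ (A *ᵥ d) i) {α : ℝ} (hα : 0 ≤ α) :
    b i ≤ (A *ᵥ (x + α • d)) i := by
  have h := residual_along A b x d α i
  nlinarith

/-- **(11.21): the step keeps feasibility.** If `x` is feasible and `0 ≤ α ≤ α_i` for every
decreasing constraint `i ∈ I_k` (in particular for `α_k = min_{i ∈ I_k} α_i`), then `x + αd` is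
feasible. [cite: AntoniouLu2007, §11.2.3 (11.20)–(11.21)] -/
theorem step_feasible (A : Matrix m n ℝ) (b : m → ℝ) {x d : n → ℝ} (hx : Feasible A b x) {α : ℝ}
    (hα : 0 ≤ α) (hmin : ∀ i, (A *ᵥ d) i < 0 → α ≤ ((A *ᵥ x) i - b i) / (-(A *ᵥ d) i)) :
    Feasible A b (x + α • d) := by
  intro i
  by_cases hd : (A *ᵥ d) i < 0
  · exact decreasing_feasible_of_le_ratio A b hd (hmin i hd)
  · exact nondecreasing_feasible A b (hx i) (not_lt.mp hd) hα

/-- **(11.21) attains a new active constraint.** With `I_k` a nonempty finite set of decreasing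
constraints and `α_k` the least ratio over it, some `i* ∈ I_k` is active at `x + α_k d`.
[cite: AntoniouLu2007, §11.2.3 (11.21)–(11.22)] -/
theorem step_new_active (A : Matrix m n ℝ) (b : m → ℝ) {x d : n → ℝ} (I : Finset m)
    (hI : I.Nonempty)
    (hdec : ∀ i ∈ I, (A *ᵥ d) i < 0) :
    ∃ i ∈ I, Active A b (x + (I.inf' hI fun j => ((A *ᵥ x) j - b j) / (-(A *ᵥ d) j)) • d) i := by
  obtain ⟨i, hi, heq⟩ := Finset.exists_mem_eq_inf' hI fun j => ((A *ᵥ x) j - b j) / (-(A *ᵥ d) j)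
  exact ⟨i, hi, by rw [heq]; exact decreasing_active_at_ratio A b (hdec i hi)⟩

/-- **(11.22): the rank gain.** A row `a_i` with `a_iᵀd ≠ 0` is not in the span of rows that
annihilate `d` (all active rows do, by (11.18)); appending it to `A_{a_k}` raises the rank by one.
[cite: AntoniouLu2007, §11.2.3 (11.20), (11.22)] -/
theorem row_not_mem_span_of_dir (A : Matrix m n ℝ) {d : n → ℝ} (S : Set m)
    (hS : ∀ j ∈ S, A j ⬝ᵥ d = 0) {i : m} (hi : A i ⬝ᵥ d ≠ 0) :
    A i ∉ Submodule.span ℝ (A '' S) := by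
  intro hmem
  apply hi
  refine Submodule.span_induction (p := fun v _ => v ⬝ᵥ d = 0) ?_ ?_ ?_ ?_ hmem
  · rintro v ⟨j, hj, rfl⟩; exact hS j hj
  · exact zero_dotProduct d
  · intro v w _ _ hv hw; rw [add_dotProduct, hv, hw, add_zero]
  · intro r v _ hv; rw [smul_dotProduct, hv, smul_zero]

/-- The `i`-th row acts by the dot product: `(A d)_i = a_iᵀd`. [cite: AntoniouLu2007, §11.2.3
(11.13)] -/
theorem mulVec_eq_row_dot (A : Matrix m n ℝ) (d : n → ℝ) (i : m) : (A *ᵥ d) i = A i ⬝ᵥ d := rfl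

/-! ### Vertex minimisers (§11.2.4): Theorems 11.5 and 11.7 -/

/-- **Theorem 11.5, key step.** If `c = A_aᵀμ_a` is a combination of the active rows ((11.35)) and
`d ∈ N(A_a)`, the objective is unchanged along `d`: `cᵀ(x + αd) = cᵀx` — so the vertex-finding
steps started at a minimiser produce minimisers. [cite: AntoniouLu2007, §11.2.4 Theorem 11.5
(proof, (11.34)–(11.35))] -/
theorem objective_const_of_nullspace_dir (A : Matrix m n ℝ) (c : n → ℝ) (S : Finset m) (μ : m → ℝ)
    (hc : c = ∑ i ∈ S, μ i • A i) {d : n → ℝ} (hd : ∀ i ∈ S, A i ⬝ᵥ d = 0) (x : n → ℝ) (α : ℝ) :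
    c ⬝ᵥ (x + α • d) = c ⬝ᵥ x := by
  have hcd : c ⬝ᵥ d = 0 := by
    rw [dotProduct_comm, hc, dotProduct_sum]
    refine Finset.sum_eq_zero fun i hi => ?_
    rw [dotProduct_smul, dotProduct_comm, hd i hi, smul_zero]
  rw [dotProduct_add, dotProduct_smul, hcd, smul_zero, add_zero]

/-- **Theorem 11.7, core.** If `c = A_{a*}ᵀμ_a*` with `μ_a* > 0` at the minimiser `x*`, then any
feasible `y` with `cᵀy ≤ cᵀx*` keeps every active constraint of `x*` tight along `y − x*`:
`a_iᵀ(y − x*) = 0`. [cite: AntoniouLu2007, §11.2.4 Theorem 11.7 (proof)] -/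
theorem active_dirs_vanish_of_positive_multipliers (A : Matrix m n ℝ) (b : m → ℝ) (c : n → ℝ)
    (S : Finset m) (μ : m → ℝ) (hc : c = ∑ i ∈ S, μ i • A i) (hμ : ∀ i ∈ S, 0 < μ i) {xs y : n → ℝ}
    (hS : ∀ i ∈ S, Active A b xs i) (hy : Feasible A b y) (hopt : c ⬝ᵥ y ≤ c ⬝ᵥ xs) :
    ∀ i ∈ S, A i ⬝ᵥ (y - xs) = 0 := by
  have hnn : ∀ i ∈ S, 0 ≤ μ i * (A i ⬝ᵥ (y - xs)) := fun i hi =>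
    mul_nonneg (hμ i hi).le (activeRows_dir_nonneg A b hy (hS i hi))
  have hsum : ∑ i ∈ S, μ i * (A i ⬝ᵥ (y - xs)) = c ⬝ᵥ (y - xs) := by
    rw [dotProduct_comm, hc, dotProduct_sum]
    refine Finset.sum_congr rfl fun i _ => ?_
    rw [dotProduct_smul, dotProduct_comm, smul_eq_mul]
  have hle : ∑ i ∈ S, μ i * (A i ⬝ᵥ (y - xs)) ≤ 0 := by
    rw [hsum, dotProduct_sub]; linarith
  have hzero := (Finset.sum_eq_zero_iff_of_nonneg hnn).mp (le_antisymm hle (Finset.sum_nonneg hnn))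
  intro i hi
  rcases mul_eq_zero.mp (hzero i hi) with h | h
  · exact absurd h (hμ i hi).ne'
  · exact h

/-- **Theorem 11.7 (uniqueness).** If moreover the active rows at the vertex `x*` have trivial
common null space (`rank A_{a*} = n`), then `x*` is the unique minimiser.
[cite: AntoniouLu2007, §11.2.4 Theorem 11.7] -/
theorem unique_minimizer_of_positive_multipliers (A : Matrix m n ℝ) (b : m → ℝ) (c : n → ℝ)
    (S : Finset m) (μ : m → ℝ) (hc : c = ∑ i ∈ S, μ i • A i) (hμ : ∀ i ∈ S, 0 < μ i) {xs y : n → ℝ}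
    (hS : ∀ i ∈ S, Active A b xs i) (hrank : ∀ v : n → ℝ, (∀ i ∈ S, A i ⬝ᵥ v = 0) → v = 0)
    (hy : Feasible A b y) (hopt : c ⬝ᵥ y ≤ c ⬝ᵥ xs) : y = xs :=
  sub_eq_zero.mp (hrank _ (active_dirs_vanish_of_positive_multipliers A b c S μ hc hμ hS hy hopt))

/-! ### Phase 1: `minimise φ subject to Ax + φe ≥ b, φ ≥ 0` ((11.23)–(11.25)) -/

/-- Phase-1 feasibility: `Ax + φe ≥ b` and `φ ≥ 0`. [cite: AntoniouLu2007, §11.2.3 (11.23),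
(11.25)] -/
def PhaseOneFeasible (A : Matrix m n ℝ) (b : m → ℝ) (x : n → ℝ) (φ : ℝ) : Prop :=
  0 ≤ φ ∧ ∀ i, b i ≤ (A *ᵥ x) i + φ

/-- **(11.24).** `x = 0`, `φ₀ = max(0, b_1, …, b_p)` is phase-1 feasible.
[cite: AntoniouLu2007, §11.2.3 (11.23)–(11.24)] -/
theorem phaseOne_initial_feasible [Fintype m] [Nonempty m] (A : Matrix m n ℝ) (b : m → ℝ) :
    PhaseOneFeasible A b 0 (max 0 (Finset.univ.sup' Finset.univ_nonempty b)) := by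
  refine ⟨le_max_left _ _, fun i => ?_⟩
  rw [mulVec_zero, Pi.zero_apply, zero_add]
  exact le_trans (Finset.le_sup' b (Finset.mem_univ i)) (le_max_right _ _)

/-- Simpler form of (11.24): any `φ ≥ max(0, b_i ∀ i)` makes `(0, φ)` phase-1 feasible.
[cite: AntoniouLu2007, §11.2.3 (11.24)] -/
theorem phaseOne_feasible_of_bound (A : Matrix m n ℝ) (b : m → ℝ) {φ : ℝ} (h0 : 0 ≤ φ)
    (hb : ∀ i, b i ≤ φ) : PhaseOneFeasible A b 0 φ :=
  ⟨h0, fun i => by rw [mulVec_zero, Pi.zero_apply, zero_add]; exact hb i⟩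

/-- A phase-1 point with `φ = 0` is feasible for `Ax ≥ b`. [cite: AntoniouLu2007, §11.2.3 (11.25),
"if the solution is … φ* = 0"] -/
theorem feasible_of_phaseOne_zero (A : Matrix m n ℝ) (b : m → ℝ) {x : n → ℝ}
    (h : PhaseOneFeasible A b x 0) : Feasible A b x := fun i => by simpa using h.2 i

/-- A feasible `x` gives the phase-1 point `(x, 0)`, so the phase-1 optimal value is `0` whenever
`Ax ≥ b` is feasible. [cite: AntoniouLu2007, §11.2.3 (11.25)] -/
theorem phaseOne_value_zero_of_feasible (A : Matrix m n ℝ) (b : m → ℝ) {x : n → ℝ}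
    (hx : Feasible A b x) : PhaseOneFeasible A b x 0 :=
  ⟨le_refl _, fun i => by simpa using hx i⟩

/-- Conversely, if every phase-1 feasible point has `φ ≥ φ* > 0`, the constraints `Ax ≥ b` are
infeasible. [cite: AntoniouLu2007, §11.2.3 (11.25)] -/
theorem infeasible_of_phaseOne_pos (A : Matrix m n ℝ) (b : m → ℝ) {φs : ℝ} (hpos : 0 < φs)
    (hmin : ∀ x φ, PhaseOneFeasible A b x φ → φs ≤ φ) : ¬ ∃ x, Feasible A b x := by
  rintro ⟨x, hx⟩
  have := hmin x 0 (phaseOne_value_zero_of_feasible A b hx)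
  linarith

end Literature.Analysis.Convex.LPVertexFinding
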